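import Literature.NumberTheory.Sieve.MaynardCollatzWielandt
import HarnessLib

/-!
# Polymath 8b Lemma 6.1 with weights of ORDER ONE: the dual bound for `M_k` collapses, by Jensen's
# inequality, to a one-dimensional concave-majorant condition

Topic `Literature/NumberTheory/Sieve`; companion of `MaynardCollatzWielandt.lean`
(`maynardFunctional_le_of_weights`, Polymath 8b Lemma 6.1 for the plain functional with general weights).
The printed weights of Corollary 6.4, `G_m(t) = ((k-1)/log k)·(1 - t_1 - ⋯ - t_k + k t_m)⁻¹`, depend on `t`
only through `t_m` and the FIBRE LENGTH `ℓ_m = 1 - ∑_{j≠m} t_j` (Polymath 8b, proof of Cor. 6.4, §6: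
"for all `t_1,…,t_{m-1},t_{m+1},…,t_k ≥ 0`" the normalisation `∫₀^∞ G_m dt_m ≤ 1` is a statement about one
fibre).  For ANY such "order-one" weight system `G_m(t) = ψ(t_m, ℓ_m)` with `∫₀^ℓ ψ(u, ℓ) du ≤ 1`, Lemma 6.1
gives `M_k ≤ sup_{t ∈ R_k} ∑_m 1/ψ(t_m, 1 - σ + t_m)` (`σ = ∑ t`), and since the summand is a function of the
single coordinate `t_m` once `σ` is fixed, Jensen's discrete inequality (Cerone–Dragomir §1.19 (1.126)) for a
concave majorant `E_σ ≥ 1/ψ(·, 1-σ+·)` on `[0, σ]` bounds the sum by `k·E_σ(σ/k)`: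

* `maynardFunctional_le_of_orderOne_weights` — if `ψ > 0` is (jointly) measurable with fibre budgets
  `∫_{(0,ℓ]} ψ(u,ℓ) du ≤ 1` (`0 ≤ ℓ ≤ 1`), and for every `σ ∈ [0,1]` a concave `E_σ` on `[0,σ]` satisfies
  `1/ψ(u, 1-σ+u) ≤ E_σ(u)` (`0 < u ≤ σ`), `0 ≤ E_σ(0)` and `k·E_σ(σ/k) ≤ Λ`, then `(∑_m J^{(m)}(F))/I(F) ≤ Λ` for
  every admissible `F` on `R_k`.

* `MaynardCW.orderOnePayoff ψ σ u` — the summand `1/G_m` of Lemma 6.1 for order-one weights at a point with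
  `∑ t = σ`, `t_m = u` (zero for `u ≤ 0`, matching the extension of `G_m` by zero), and the core reduction
  `MaynardCW.maynardFunctional_le_of_orderOnePayoff_sum_le` (Lemma 6.1 ⇒ it suffices that
  `∑_m Φ_σ(t_m) ≤ Λ` on `R_{n+1}`);
* `MaynardCW.sum_mul_le_of_twoAtomChords_le` — the discrete two-atom reduction (Carathéodory's theorem for the
  concave hull of a function of ONE variable, Rockafellar Cor. 17.1.5 with `n = 1`): if every chord of `Φ` through
  two points `a < x < b` of `D`, evaluated at `x`, is `≤ S` (and `Φ(x) ≤ S`), then `∑ p_i Φ(u_i) ≤ S` for every finite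
  probability vector `p` on points `u_i ∈ D` with barycentre `x`;
* `maynardFunctional_le_of_orderOne_twoAtom` — the PRIMAL form of the collapse: it suffices that
  `k·[(u₂-σ/k)/(u₂-u₁)·Φ_σ(u₁) + (σ/k-u₁)/(u₂-u₁)·Φ_σ(u₂)] ≤ Λ` for all `0 ≤ u₁ ≤ σ/k ≤ u₂ ≤ σ`, `u₁ < u₂`
  (`Φ_σ = orderOnePayoff ψ σ`), i.e. `k` times the upper concave envelope of `Φ_σ` at `σ/k` is `≤ Λ` — a
  three-dimensional condition in `(σ, u₁, u₂)` replacing the `k`-dimensional supremum of Lemma 6.1;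
* `MaynardCW.sum_le_of_supConv_ladder` and `maynardFunctional_le_of_orderOne_supConv` — the EXACT order-one
  bound `sup_{t∈R_k} ∑_m Φ_{∑t}(t_m) ≤ Λ` certified by a sup-convolution (dynamic-programming) ladder
  `Φ_σ(u) + W_σ^j(s-u) ≤ W_σ^{j+1}(s)`, `W_σ^k(σ) ≤ Λ` (Bellman's functional equation for
  `max ∑ g_i(x_i)` on `∑ x_i = c`), with no structural assumption on maximisers; `sum_le_of_block_one`,
  `sum_le_of_block_merge` (blocks merged along any addition chain, e.g. doubling) and the wrapper
  `maynardFunctional_le_of_orderOne_blocks`.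

Corollary 6.4 is the case `ψ(u,ℓ) = ((k-1)/log k)/(ℓ + (k-1)u)`, whose reciprocal is LINEAR in `u` (so `E_σ` can be
taken equal to it and Jensen is an equality).  No new named facts.

## References
* [Polymath8b2014] D. H. J. Polymath, *Variants of the Selberg sieve, and bounded intervals containing many
  primes*, Res. Math. Sci. 1:12 (2014) = arXiv:1407.4897v4, Lemma 6.1 and the proof of Corollary 6.4 (§6).
* [CeroneDragomir2010] P. Cerone, S. S. Dragomir, *Mathematical Inequalities: A Perspective*, CRC Press (2010),
  Ch. 1 §1.19, Jensen's discrete inequality (1.126).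
* [Rockafellar1970] R. T. Rockafellar, *Convex Analysis*, Princeton University Press (1970), §17, Theorem 17.1
  (Carathéodory) and Corollary 17.1.5 (`(conv f)(x) = inf ∑_{i ≤ n+1} λ_i f(x_i)` over convex combinations of
  `n+1` points).
* [Bellman1957] R. Bellman, *Dynamic Programming*, Princeton University Press (1957), Ch. I §6 (a
  multi-dimensional maximization problem: `max ∑ g_i(x_i)` on `x_1 + ⋯ + x_N = c`, `x_i ≥ 0`), eqs. (3)–(5):
  `f_N(c) = max_{0 ≤ x ≤ c} [g_N(x) + f_{N-1}(c - x)]`, `f_1 = g_1`.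
-/

noncomputable section

open MeasureTheory Set Filter Finset
open scoped ENNReal BigOperators

namespace Literature.NumberTheory.Sieve

namespace MaynardCW

/-! ### Order-one payoff and the core reduction -/

/-- The ORDER-ONE PAYOFF `Φ_σ(u)`: the summand `1/G_m(t)` of Polymath 8b Lemma 6.1 for order-one weights
`G_m(t) = ψ(t_m, ℓ_m)`, `ℓ_m = 1 - ∑_{j≠m} t_j = 1 - σ + t_m` (`σ = t_1 + ⋯ + t_k`), as a function of the single
coordinate `u = t_m` once `σ` is fixed; it is set to `0` for `u ≤ 0` (the face `t_m = 0`, where `G_m` is extended by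
zero and contributes nothing).  For the weights of Corollary 6.4, `Φ_σ(u) = (log k/(k-1))·(1 - σ + k u)`.
[cite: Polymath8b2014, Lemma 6.1 and proof of Corollary 6.4 (§6)] -/
def orderOnePayoff (ψ : ℝ → ℝ → ℝ) (σ u : ℝ) : ℝ := if 0 < u then (ψ u (1 - σ + u))⁻¹ else 0

/-- [cite: Polymath8b2014, Lemma 6.1 and proof of Corollary 6.4 (§6)] -/
theorem orderOnePayoff_of_pos (ψ : ℝ → ℝ → ℝ) {σ u : ℝ} (hu : 0 < u) :
    orderOnePayoff ψ σ u = (ψ u (1 - σ + u))⁻¹ := if_pos hu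

/-- [cite: Polymath8b2014, Lemma 6.1 and proof of Corollary 6.4 (§6)] -/
theorem orderOnePayoff_of_not_pos (ψ : ℝ → ℝ → ℝ) {σ u : ℝ} (hu : ¬ 0 < u) :
    orderOnePayoff ψ σ u = 0 := if_neg hu

/-- The payoff is nonnegative on `[0, σ]`, `σ ≤ 1`, when `ψ > 0` on `0 < u ≤ ℓ ≤ 1`.
[cite: Polymath8b2014, Lemma 6.1 and proof of Corollary 6.4 (§6)] -/
theorem orderOnePayoff_nonneg (ψ : ℝ → ℝ → ℝ)
    (hψpos : ∀ u ℓ : ℝ, 0 < u → u ≤ ℓ → ℓ ≤ 1 → 0 < ψ u ℓ) {σ u : ℝ} (hσ : σ ≤ 1) (hu : u ≤ σ) :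
    0 ≤ orderOnePayoff ψ σ u := by
  by_cases h : 0 < u
  · rw [orderOnePayoff_of_pos ψ h]
    exact (inv_pos.2 (hψpos _ _ h (by linarith) (by linarith))).le
  · rw [orderOnePayoff_of_not_pos ψ h]

/-- Core of the order-one collapse: Polymath 8b Lemma 6.1 (`maynardFunctional_le_of_weights`) for the weights
`w_m(t) = 1/ψ(t_m, 1 - ∑_{j≠m} t_j)`; the fibre budgets come from `∫_{(0,ℓ]} ψ(u,ℓ) du ≤ 1` because the fibre
length `ℓ = 1 - ∑ s` does not depend on `t_m`, and the pointwise sum of Lemma 6.1 is `∑_m Φ_σ(t_m)`.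
[cite: Polymath8b2014, Lemma 6.1 and proof of Corollary 6.4 (§6)] -/
theorem maynardFunctional_le_of_orderOnePayoff_sum_le {n : ℕ} {Λ : ℝ} (ψ : ℝ → ℝ → ℝ)
    (hψm : Measurable fun p : ℝ × ℝ => ψ p.1 p.2)
    (hψpos : ∀ u ℓ : ℝ, 0 < u → u ≤ ℓ → ℓ ≤ 1 → 0 < ψ u ℓ)
    (hnorm : ∀ ℓ : ℝ, 0 ≤ ℓ → ℓ ≤ 1 → ∫⁻ u in Ioc (0:ℝ) ℓ, ENNReal.ofReal (ψ u ℓ) ≤ 1)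
    (hΛ0 : 0 ≤ Λ)
    (hpt : ∀ t ∈ maynardSimplex (n + 1), ∑ m, orderOnePayoff ψ (∑ j, t j) (t m) ≤ Λ)
    {F : (Fin (n + 1) → ℝ) → ℝ} (hF : IsMaynardAdmissible (n + 1) F) :
    maynardFunctional (n + 1) F ≤ Λ := by
  -- the order-one weights
  set w : Fin (n + 1) → (Fin (n + 1) → ℝ) → ℝ :=
    fun m t => (ψ (t m) (1 - ∑ j ∈ univ.erase m, t j))⁻¹ with hw
  have hwm : ∀ m, Measurable (w m) := by
    intro m
    have h1 : Measurable fun t : Fin (n + 1) → ℝ => (t m, 1 - ∑ j ∈ univ.erase m, t j) :=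
      (measurable_pi_apply m).prodMk
        (measurable_const.sub (Finset.measurable_sum _ fun j _ => measurable_pi_apply j))
    exact (hψm.comp h1).inv
  refine maynardFunctional_le_of_weights hΛ0 hF w hwm ?_ ?_ ?_
  · -- positivity where `F ≠ 0`, `t_m > 0`
    intro m t hFt htm
    have ht : t ∈ maynardSimplex (n + 1) := hF.support_subset (Function.mem_support.2 hFt)
    have hℓ : 1 - ∑ j ∈ univ.erase m, t j = 1 - ∑ j, t j + t m := sub_sum_erase_eq m t
    simp only [hw, hℓ]
    refine inv_pos.2 (hψpos _ _ htm ?_ ?_)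
    · linarith [ht.2]
    · have : t m ≤ ∑ j, t j := Finset.single_le_sum (fun j _ => ht.1 j) (Finset.mem_univ m)
      linarith
  · -- fibre budgets
    intro m s hs0 hs1
    have hsum : 0 ≤ ∑ j, s j := Finset.sum_nonneg fun j _ => hs0 j
    calc ∫⁻ u in Ioc (0:ℝ) (1 - ∑ j, s j), ENNReal.ofReal (w m (Fin.insertNth m u s))⁻¹
        = ∫⁻ u in Ioc (0:ℝ) (1 - ∑ j, s j), ENNReal.ofReal (ψ u (1 - ∑ j, s j)) := by
          refine setLIntegral_congr_fun measurableSet_Ioc fun u hu => ?_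
          simp only [hw, sub_sum_erase_insertNth, Fin.insertNth_apply_same, inv_inv]
      _ ≤ 1 := hnorm _ (by linarith) (by linarith)
  · -- the pointwise sum of Lemma 6.1 is `∑_m Φ_σ(t_m)`
    intro t ht
    have h : ∀ m, (if 0 < t m then w m t else 0) = orderOnePayoff ψ (∑ j, t j) (t m) := by
      intro m
      simp only [hw, orderOnePayoff, sub_sum_erase_eq m t]
    simpa only [h] using hpt t ht

/-! ### The discrete two-atom reduction (Carathéodory in dimension one) -/

/-- **Two-atom reduction for barycentre-constrained finite measures on a line** (the concave/`sup` form of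
Rockafellar's Corollary 17.1.5 with `n = 1`: `(conv f)(x)` is the infimum of `λ f(x_1) + (1-λ) f(x_2)` over
two-point convex combinations `λ x_1 + (1-λ) x_2 = x`, so every finite convex combination with barycentre `x`
is bounded by the two-point ones).  Concretely: let `Φ : ℝ → ℝ`, `D ⊆ ℝ`, `x, S ∈ ℝ` with `Φ(x) ≤ S` if `x ∈ D` and
`((b-x)Φ(a) + (x-a)Φ(b))/(b-a) ≤ S` for all `a, b ∈ D` with `a < x < b`.  Then `∑_{i∈s} p_i Φ(u_i) ≤ S` whenever
`p_i ≥ 0`, `∑_{i∈s} p_i = 1`, `∑_{i∈s} p_i u_i = x` and all `u_i ∈ D`.  (Proof as printed for Carathéodory's theorem: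
peel off the largest multiple of the two-atom measure on a pair of atoms `u_a < x < u_b` and induct on the support.)
[cite: Rockafellar1970, §17, Theorem 17.1 and Corollary 17.1.5 (case n = 1)] -/
theorem sum_mul_le_of_twoAtomChords_le {ι : Type*} {Φ : ℝ → ℝ} {D : Set ℝ} {x S : ℝ} (u : ι → ℝ)
    (hdeg : x ∈ D → Φ x ≤ S)
    (hchord : ∀ a ∈ D, ∀ b ∈ D, a < x → x < b →
      (b - x) / (b - a) * Φ a + (x - a) / (b - a) * Φ b ≤ S)
    (s : Finset ι) :
    ∀ p : ι → ℝ, (∀ i ∈ s, 0 ≤ p i) → ∑ i ∈ s, p i = 1 → ∑ i ∈ s, p i * u i = x →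
      (∀ i ∈ s, u i ∈ D) → ∑ i ∈ s, p i * Φ (u i) ≤ S := by
  classical
  induction s using Finset.strongInduction with
  | H s ih =>
  intro p hp hp1 hmean hu
  by_cases hex : ∃ i ∈ s, p i ≠ 0 ∧ u i ≠ x
  swap
  · -- all the mass sits at `x`
    push Not at hex
    have hsum : ∑ i ∈ s, p i * Φ (u i) = ∑ i ∈ s, p i * Φ x := by
      refine Finset.sum_congr rfl fun i hi => ?_
      by_cases hpi : p i = 0
      · rw [hpi, zero_mul, zero_mul]
      · rw [hex i hi hpi]
    obtain ⟨i, hi, hpi⟩ : ∃ i ∈ s, p i ≠ 0 := by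
      by_contra h
      push Not at h
      rw [Finset.sum_eq_zero h] at hp1
      exact zero_ne_one hp1
    have hxD : x ∈ D := hex i hi hpi ▸ hu i hi
    rw [hsum, ← Finset.sum_mul, hp1, one_mul]
    exact hdeg hxD
  obtain ⟨i₀, hi₀, hpi₀, hui₀⟩ := hex
  -- the centred first moment vanishes and has a nonzero term: there are atoms strictly on both sides of `x`
  have hg0 : ∑ i ∈ s, p i * (u i - x) = 0 := by
    simp only [mul_sub, Finset.sum_sub_distrib, ← Finset.sum_mul, hmean, hp1, one_mul, sub_self]
  have hgi₀ : p i₀ * (u i₀ - x) ≠ 0 := mul_ne_zero hpi₀ (sub_ne_zero.2 hui₀)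
  obtain ⟨a, ha, hga⟩ : ∃ a ∈ s, p a * (u a - x) < 0 := by
    by_contra h
    push Not at h
    exact hgi₀ ((Finset.sum_eq_zero_iff_of_nonneg h).1 hg0 i₀ hi₀)
  obtain ⟨b, hb, hgb⟩ : ∃ b ∈ s, 0 < p b * (u b - x) := by
    by_contra h
    push Not at h
    have h' : ∀ i ∈ s, 0 ≤ p i * (x - u i) := fun i hi => by linarith [h i hi]
    have h0' : ∑ i ∈ s, p i * (x - u i) = 0 := by
      have : ∑ i ∈ s, p i * (x - u i) = -∑ i ∈ s, p i * (u i - x) := by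
        rw [← Finset.sum_neg_distrib]
        exact Finset.sum_congr rfl fun i _ => by ring
      rw [this, hg0, neg_zero]
    have := (Finset.sum_eq_zero_iff_of_nonneg h').1 h0' i₀ hi₀
    exact hgi₀ (by linarith)
  have hpa : 0 < p a := by
    rcases (hp a ha).eq_or_lt with h | h
    · rw [← h, zero_mul] at hga
      exact absurd hga (lt_irrefl 0)
    · exact h
  have hpb : 0 < p b := by
    rcases (hp b hb).eq_or_lt with h | h
    · rw [← h, zero_mul] at hgb
      exact absurd hgb (lt_irrefl 0)
    · exact h
  have hua : u a < x := by
    by_contra h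
    push Not at h
    have : 0 ≤ p a * (u a - x) := mul_nonneg hpa.le (sub_nonneg.2 h)
    linarith
  have hub : x < u b := by
    by_contra h
    push Not at h
    have : p b * (u b - x) ≤ 0 := by nlinarith [hpb.le, sub_nonpos.2 h]
    linarith
  have hne : a ≠ b := by
    rintro rfl
    exact lt_asymm hua hub
  have hd : 0 < u b - u a := by linarith
  -- the two-atom measure on `{u_a, u_b}` with barycentre `x`
  set qa : ℝ := (u b - x) / (u b - u a) with hqa
  set qb : ℝ := (x - u a) / (u b - u a) with hqb
  have hqa0 : 0 < qa := div_pos (sub_pos.2 hub) hd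
  have hqb0 : 0 < qb := div_pos (sub_pos.2 hua) hd
  have hq1 : qa + qb = 1 := by
    rw [hqa, hqb, ← add_div, div_eq_one_iff_eq hd.ne']
    ring
  have hqx : qa * u a + qb * u b = x := by
    rw [hqa, hqb]
    field_simp
    ring
  have hchordS : qa * Φ (u a) + qb * Φ (u b) ≤ S := hchord (u a) (hu a ha) (u b) (hu b hb) hua hub
  obtain ⟨q, hq_def⟩ : ∃ q : ι → ℝ, ∀ i, q i = (if i = a then qa else 0) + (if i = b then qb else 0) :=
    ⟨_, fun _ => rfl⟩
  have hq : ∀ f : ι → ℝ, ∑ i ∈ s, q i * f i = qa * f a + qb * f b := by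
    intro f
    simp only [hq_def, add_mul, ite_mul, zero_mul, Finset.sum_add_distrib, Finset.sum_ite_eq', if_pos ha,
      if_pos hb]
  have hsq : ∑ i ∈ s, q i = 1 := by
    have := hq fun _ => 1
    simpa only [mul_one, hq1] using this
  -- the largest multiple `lam` of the two-atom measure below `p`
  obtain ⟨lam, hlam⟩ : ∃ lam : ℝ, lam = min (p a / qa) (p b / qb) := ⟨_, rfl⟩
  have hlam0 : 0 < lam := hlam ▸ lt_min (div_pos hpa hqa0) (div_pos hpb hqb0)
  have hlama : lam * qa ≤ p a := by
    have : lam ≤ p a / qa := hlam ▸ min_le_left _ _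
    rwa [le_div_iff₀ hqa0] at this
  have hlamb : lam * qb ≤ p b := by
    have : lam ≤ p b / qb := hlam ▸ min_le_right _ _
    rwa [le_div_iff₀ hqb0] at this
  have hqle : ∀ i ∈ s, lam * q i ≤ p i := by
    intro i hi
    rw [hq_def]
    by_cases h1 : i = a
    · subst h1
      rw [if_pos rfl, if_neg hne, add_zero]
      exact hlama
    · by_cases h2 : i = b
      · subst h2
        rw [if_neg h1, if_pos rfl, zero_add]
        exact hlamb
      · rw [if_neg h1, if_neg h2, add_zero, mul_zero]
        exact hp i hi
  -- the remainder `p' = p - lam • q`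
  obtain ⟨p', hp'_def⟩ : ∃ p' : ι → ℝ, ∀ i, p' i = p i - lam * q i := ⟨_, fun _ => rfl⟩
  have hp'0 : ∀ i ∈ s, 0 ≤ p' i := fun i hi => by rw [hp'_def]; exact sub_nonneg.2 (hqle i hi)
  have hp'1 : ∑ i ∈ s, p' i = 1 - lam := by
    simp only [hp'_def, Finset.sum_sub_distrib, ← Finset.mul_sum, hsq, hp1, mul_one]
  have hp'mean : ∑ i ∈ s, p' i * u i = (1 - lam) * x := by
    simp only [hp'_def, sub_mul, Finset.sum_sub_distrib, hmean, mul_assoc, ← Finset.mul_sum, hq, hqx]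
    ring
  have hsplit : ∑ i ∈ s, p i * Φ (u i) =
      lam * (qa * Φ (u a) + qb * Φ (u b)) + ∑ i ∈ s, p' i * Φ (u i) := by
    simp only [hp'_def, sub_mul, Finset.sum_sub_distrib, mul_assoc, ← Finset.mul_sum, hq]
    ring
  have hlam1 : lam ≤ 1 := by
    have : 0 ≤ ∑ i ∈ s, p' i := Finset.sum_nonneg hp'0
    linarith [hp'1]
  rcases hlam1.eq_or_lt with h1 | h1
  · -- `lam = 1`: `p` is exactly the two-atom measure
    have hz : ∀ i ∈ s, p' i = 0 :=
      (Finset.sum_eq_zero_iff_of_nonneg hp'0).1 (by rw [hp'1, h1, sub_self])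
    have h0 : ∑ i ∈ s, p' i * Φ (u i) = 0 :=
      Finset.sum_eq_zero fun i hi => by rw [hz i hi, zero_mul]
    rw [hsplit, h0, add_zero, h1, one_mul]
    exact hchordS
  · -- `lam < 1`: the normalised remainder has lost the atom `a` or the atom `b`; induct
    have hc : 0 < 1 - lam := sub_pos.2 h1
    obtain ⟨e, he, hpe⟩ : ∃ e ∈ s, p' e = 0 := by
      rcases min_choice (p a / qa) (p b / qb) with h | h
      · refine ⟨a, ha, ?_⟩
        rw [hp'_def, hq_def, if_pos rfl, if_neg hne, add_zero, hlam, h, div_mul_cancel₀ _ hqa0.ne', sub_self]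
      · refine ⟨b, hb, ?_⟩
        rw [hp'_def, hq_def, if_neg (Ne.symm hne), if_pos rfl, zero_add, hlam, h,
          div_mul_cancel₀ _ hqb0.ne', sub_self]
    obtain ⟨p'', hp''_def⟩ : ∃ p'' : ι → ℝ, ∀ i, p'' i = p' i / (1 - lam) := ⟨_, fun _ => rfl⟩
    have hp''e : p'' e = 0 := by rw [hp''_def, hpe, zero_div]
    have hp''u : p'' e * u e = 0 := by rw [hp''e, zero_mul]
    have hp''Φ : p'' e * Φ (u e) = 0 := by rw [hp''e, zero_mul]
    have IH := ih (s.erase e) (Finset.erase_ssubset he) p''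
      (fun i hi => by rw [hp''_def]; exact div_nonneg (hp'0 i (Finset.mem_of_mem_erase hi)) hc.le)
      (by
        rw [Finset.sum_erase s hp''e]
        simp only [hp''_def]
        rw [← Finset.sum_div, hp'1, div_self hc.ne'])
      (by
        rw [Finset.sum_erase s hp''u]
        simp only [hp''_def, div_mul_eq_mul_div]
        rw [← Finset.sum_div, hp'mean, mul_div_cancel_left₀ _ hc.ne'])
      (fun i hi => hu i (Finset.mem_of_mem_erase hi))
    rw [Finset.sum_erase s hp''Φ] at IH
    simp only [hp''_def, div_mul_eq_mul_div] at IH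
    rw [← Finset.sum_div, div_le_iff₀ hc] at IH
    rw [hsplit]
    calc lam * (qa * Φ (u a) + qb * Φ (u b)) + ∑ i ∈ s, p' i * Φ (u i)
        ≤ lam * S + S * (1 - lam) := add_le_add (mul_le_mul_of_nonneg_left hchordS hlam0.le) IH
      _ = S := by ring

end MaynardCW


open MaynardCW in
/-- **Polymath 8b Lemma 6.1 with order-one weights `G_m = ψ(t_m, ℓ_m)`, collapsed by Jensen's inequality.**
Let `ψ : ℝ → ℝ → ℝ` be jointly measurable with `ψ(u, ℓ) > 0` for `0 < u ≤ ℓ ≤ 1` and fibre budgets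
`∫_{(0,ℓ]} ψ(u, ℓ) du ≤ 1` for `0 ≤ ℓ ≤ 1` (the normalisation `∫₀^∞ G_m dt_m ≤ 1` of Lemma 6.1 for
`G_m(t) = ψ(t_m, 1 - ∑_{j≠m} t_j)`).  Suppose that for every `σ ∈ [0,1]` there is a function `E_σ`, concave on
`[0, σ]`, with `E_σ(0) ≥ 0`, `1/ψ(u, 1 - σ + u) ≤ E_σ(u)` for `0 < u ≤ σ`, and `(n+1)·E_σ(σ/(n+1)) ≤ Λ`.  Then
`(∑_m J^{(m)}_{n+1}(F))/I_{n+1}(F) ≤ Λ` for every admissible `F` (so `M_{n+1} ≤ Λ`).  Proof: Lemma 6.1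
(`maynardFunctional_le_of_weights`) with `w_m = 1/ψ(t_m, ℓ_m)`; at a point `t ∈ R_{n+1}` with `∑ t = σ` one has
`ℓ_m = 1 - σ + t_m`, and Jensen's discrete inequality (1.126) for the concave `E_σ` at the points
`t_0, …, t_n ∈ [0, σ]` with equal weights gives `∑_m E_σ(t_m) ≤ (n+1) E_σ(σ/(n+1))`.
[cite: Polymath8b2014, Lemma 6.1 and proof of Corollary 6.4 (§6); CeroneDragomir2010, §1.19 Jensen's discrete inequality (1.126)] -/
theorem maynardFunctional_le_of_orderOne_weights {n : ℕ} {Λ : ℝ} (ψ : ℝ → ℝ → ℝ)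
    (hψm : Measurable fun p : ℝ × ℝ => ψ p.1 p.2)
    (hψpos : ∀ u ℓ : ℝ, 0 < u → u ≤ ℓ → ℓ ≤ 1 → 0 < ψ u ℓ)
    (hnorm : ∀ ℓ : ℝ, 0 ≤ ℓ → ℓ ≤ 1 → ∫⁻ u in Ioc (0:ℝ) ℓ, ENNReal.ofReal (ψ u ℓ) ≤ 1)
    (E : ℝ → ℝ → ℝ) (hE : ∀ σ ∈ Icc (0:ℝ) 1, ConcaveOn ℝ (Icc (0:ℝ) σ) (E σ))
    (hE0 : ∀ σ ∈ Icc (0:ℝ) 1, 0 ≤ E σ 0)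
    (hmaj : ∀ σ ∈ Icc (0:ℝ) 1, ∀ u : ℝ, 0 < u → u ≤ σ → (ψ u (1 - σ + u))⁻¹ ≤ E σ u)
    (hΛ : ∀ σ ∈ Icc (0:ℝ) 1, ((n:ℝ) + 1) * E σ (σ / ((n:ℝ) + 1)) ≤ Λ)
    {F : (Fin (n + 1) → ℝ) → ℝ} (hF : IsMaynardAdmissible (n + 1) F) :
    maynardFunctional (n + 1) F ≤ Λ := by
  have hk : (0:ℝ) < (n:ℝ) + 1 := by positivity
  -- `Λ ≥ 0` from `σ = 0`
  have hΛ0 : 0 ≤ Λ := by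
    have h0 : (0:ℝ) ∈ Icc (0:ℝ) 1 := ⟨le_rfl, zero_le_one⟩
    have := hΛ 0 h0
    rw [zero_div] at this
    nlinarith [hE0 0 h0]
  refine maynardFunctional_le_of_orderOnePayoff_sum_le ψ hψm hψpos hnorm hΛ0 ?_ hF
  -- pointwise bound on `R_{n+1}` by Jensen
  intro t ht
  set σ : ℝ := ∑ j, t j with hσ
  have hσmem : σ ∈ Icc (0:ℝ) 1 := ⟨Finset.sum_nonneg fun j _ => ht.1 j, ht.2⟩
  have htm_le : ∀ m, t m ≤ σ := fun m =>
    Finset.single_le_sum (fun j _ => ht.1 j) (Finset.mem_univ m)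
  -- termwise majorant
  have hterm : ∀ m, orderOnePayoff ψ σ (t m) ≤ E σ (t m) := by
    intro m
    by_cases htm : 0 < t m
    · rw [orderOnePayoff_of_pos ψ htm]
      exact hmaj σ hσmem (t m) htm (htm_le m)
    · rw [orderOnePayoff_of_not_pos ψ htm]
      have h0 : t m = 0 := le_antisymm (not_lt.1 htm) (ht.1 m)
      rw [h0]
      exact hE0 σ hσmem
  -- Jensen with equal weights
  have hJ : ∑ m, (1 / ((n:ℝ) + 1)) • E σ (t m) ≤ E σ (∑ m, (1 / ((n:ℝ) + 1)) • t m) :=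
    (hE σ hσmem).le_map_sum (t := Finset.univ) (w := fun _ => 1 / ((n:ℝ) + 1)) (p := fun m => t m)
      (fun _ _ => by positivity) (by simp [Finset.card_univ, Fintype.card_fin]; field_simp)
      (fun m _ => ⟨ht.1 m, htm_le m⟩)
  have hJ' : ∑ m, E σ (t m) ≤ ((n:ℝ) + 1) * E σ (σ / ((n:ℝ) + 1)) := by
    have h1 : ∑ m, (1 / ((n:ℝ) + 1)) • E σ (t m) = (∑ m, E σ (t m)) / ((n:ℝ) + 1) := by
      rw [← Finset.smul_sum, smul_eq_mul]; ring
    have h2 : ∑ m, (1 / ((n:ℝ) + 1)) • t m = σ / ((n:ℝ) + 1) := by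
      rw [← Finset.smul_sum, smul_eq_mul, ← hσ]; ring
    rw [h1, h2, div_le_iff₀ hk] at hJ
    linarith
  calc ∑ m, orderOnePayoff ψ σ (t m) ≤ ∑ m, E σ (t m) := Finset.sum_le_sum fun m _ => hterm m
    _ ≤ ((n:ℝ) + 1) * E σ (σ / ((n:ℝ) + 1)) := hJ'
    _ ≤ Λ := hΛ σ hσmem

open MaynardCW in
/-- **Order-one collapse, primal (two-atom) form** — the relaxed dual bound of Lemma 6.1 for order-one weights
is a three-dimensional condition.  Let `ψ` be as in `maynardFunctional_le_of_orderOne_weights` (jointly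
measurable, `ψ(u,ℓ) > 0` for `0 < u ≤ ℓ ≤ 1`, fibre budgets `∫_{(0,ℓ]} ψ(u,ℓ) du ≤ 1` for `0 ≤ ℓ ≤ 1`), and let
`Φ_σ = orderOnePayoff ψ σ` (`Φ_σ(u) = 1/ψ(u, 1-σ+u)` for `u > 0`, `Φ_σ(u) = 0` for `u ≤ 0`).  If for every
`σ ∈ [0,1]` and all `0 ≤ u₁ ≤ σ/(n+1) ≤ u₂ ≤ σ` with `u₁ < u₂`
`(n+1)·[ (u₂ - σ/(n+1))/(u₂ - u₁)·Φ_σ(u₁) + (σ/(n+1) - u₁)/(u₂ - u₁)·Φ_σ(u₂) ] ≤ Λ`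
(i.e. `n+1` times the value at the barycentre `σ/(n+1)` of every chord of `Φ_σ` — the upper concave envelope of
`Φ_σ` at `σ/(n+1)` — is at most `Λ`), then `(∑_m J^{(m)}_{n+1}(F))/I_{n+1}(F) ≤ Λ` for every admissible `F`, so
`M_{n+1} ≤ Λ`.  Proof: Lemma 6.1 with `G_m = ψ(t_m, ℓ_m)` (`maynardFunctional_le_of_orderOnePayoff_sum_le`);
at `t ∈ R_{n+1}` with `∑ t = σ` the empirical measure of `t_0,…,t_n` is a probability measure on `[0,σ]` with
barycentre `σ/(n+1)`, and by Carathéodory's theorem on the line (`sum_mul_le_of_twoAtomChords_le`,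
Rockafellar Cor. 17.1.5 with `n = 1`) its `Φ_σ`-average is bounded by that of a two-point measure with the same
barycentre.
[cite: Polymath8b2014, Lemma 6.1 and proof of Corollary 6.4 (§6); Rockafellar1970, §17, Corollary 17.1.5 (n = 1)] -/
theorem maynardFunctional_le_of_orderOne_twoAtom {n : ℕ} {Λ : ℝ} (ψ : ℝ → ℝ → ℝ)
    (hψm : Measurable fun p : ℝ × ℝ => ψ p.1 p.2)
    (hψpos : ∀ u ℓ : ℝ, 0 < u → u ≤ ℓ → ℓ ≤ 1 → 0 < ψ u ℓ)
    (hnorm : ∀ ℓ : ℝ, 0 ≤ ℓ → ℓ ≤ 1 → ∫⁻ u in Ioc (0:ℝ) ℓ, ENNReal.ofReal (ψ u ℓ) ≤ 1)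
    (hΛ : ∀ σ ∈ Icc (0:ℝ) 1, ∀ u₁ u₂ : ℝ, 0 ≤ u₁ → u₁ ≤ σ / ((n:ℝ) + 1) → σ / ((n:ℝ) + 1) ≤ u₂ →
      u₂ ≤ σ → u₁ < u₂ →
      ((n:ℝ) + 1) * ((u₂ - σ / ((n:ℝ) + 1)) / (u₂ - u₁) * orderOnePayoff ψ σ u₁
        + (σ / ((n:ℝ) + 1) - u₁) / (u₂ - u₁) * orderOnePayoff ψ σ u₂) ≤ Λ)
    {F : (Fin (n + 1) → ℝ) → ℝ} (hF : IsMaynardAdmissible (n + 1) F) :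
    maynardFunctional (n + 1) F ≤ Λ := by
  have hk : (0:ℝ) < (n:ℝ) + 1 := by positivity
  -- `Λ ≥ 0`: the chord through `u₁ = 0 < u₂ = 1` at `σ = 1`
  have hΛ0 : 0 ≤ Λ := by
    have h := hΛ 1 ⟨zero_le_one, le_rfl⟩ 0 1 le_rfl (by positivity)
      ((div_le_one hk).2 (by linarith)) le_rfl zero_lt_one
    rw [orderOnePayoff_of_not_pos ψ (lt_irrefl 0)] at h
    simp only [mul_zero, zero_add, sub_zero, div_one] at h
    have h1 : 0 ≤ orderOnePayoff ψ 1 1 := orderOnePayoff_nonneg ψ hψpos le_rfl le_rfl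
    have h2 : ((n:ℝ) + 1) * (1 / ((n:ℝ) + 1) * orderOnePayoff ψ 1 1) = orderOnePayoff ψ 1 1 := by
      field_simp
    linarith
  refine maynardFunctional_le_of_orderOnePayoff_sum_le ψ hψm hψpos hnorm hΛ0 ?_ hF
  intro t ht
  set σ : ℝ := ∑ j, t j with hσ
  have hσmem : σ ∈ Icc (0:ℝ) 1 := ⟨Finset.sum_nonneg fun j _ => ht.1 j, ht.2⟩
  have htm_le : ∀ m, t m ≤ σ := fun m =>
    Finset.single_le_sum (fun j _ => ht.1 j) (Finset.mem_univ m)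
  set x : ℝ := σ / ((n:ℝ) + 1) with hx
  -- the chord hypotheses, divided by `n+1`
  have hdeg : x ∈ Icc (0:ℝ) σ → orderOnePayoff ψ σ x ≤ Λ / ((n:ℝ) + 1) := by
    intro hxD
    rw [le_div_iff₀' hk]
    rcases eq_or_lt_of_le hxD.1 with hx0 | hx0
    · rw [← hx0, orderOnePayoff_of_not_pos ψ (lt_irrefl 0), mul_zero]
      exact hΛ0
    · rcases eq_or_lt_of_le hxD.2 with hxσ | hxσ
      · -- `x = σ` (only when `n = 0`): the chord through `0 < σ`
        have h := hΛ σ hσmem 0 σ le_rfl hxD.1 hxD.2 le_rfl (hx0.trans_le hxD.2)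
        rw [orderOnePayoff_of_not_pos ψ (lt_irrefl 0)] at h
        have hσ0 : σ ≠ 0 := (hx0.trans_le hxD.2).ne'
        rw [← hx, mul_zero, zero_add, sub_zero, sub_zero, hxσ, div_self hσ0, one_mul] at h
        rwa [hxσ]
      · -- `x < σ`: the degenerate chord through `x < σ`
        have h := hΛ σ hσmem x σ hxD.1 le_rfl hxσ.le le_rfl hxσ
        rw [← hx] at h
        rwa [sub_self, zero_div, zero_mul, add_zero, div_self (sub_ne_zero.2 hxσ.ne'), one_mul] at h
  have hchord : ∀ a ∈ Icc (0:ℝ) σ, ∀ b ∈ Icc (0:ℝ) σ, a < x → x < b →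
      (b - x) / (b - a) * orderOnePayoff ψ σ a + (x - a) / (b - a) * orderOnePayoff ψ σ b ≤
        Λ / ((n:ℝ) + 1) := by
    intro a haD b hbD hax hxb
    rw [le_div_iff₀' hk]
    exact hΛ σ hσmem a b haD.1 hax.le hxb.le hbD.2 (hax.trans hxb)
  have key := sum_mul_le_of_twoAtomChords_le (fun m => t m) hdeg hchord Finset.univ
    (fun _ => 1 / ((n:ℝ) + 1)) (fun _ _ => by positivity)
    (by simp [Finset.card_univ, Fintype.card_fin]; field_simp)
    (by rw [← Finset.mul_sum, ← hσ, hx]; field_simp) (fun m _ => ⟨ht.1 m, htm_le m⟩)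
  rw [← Finset.mul_sum, le_div_iff₀ hk] at key
  have e : 1 / ((n:ℝ) + 1) * (∑ m, orderOnePayoff ψ σ (t m)) * ((n:ℝ) + 1) =
      ∑ m, orderOnePayoff ψ σ (t m) := by
    field_simp
  linarith

namespace MaynardCW

/-! ### Exact order-one bound by a sup-convolution ladder (dynamic programming in the number of coordinates) -/

/-- **Sup-convolution ladder for separable sums.**  If `W : ℕ → ℝ → ℝ` satisfies `Φ(s) ≤ W 1 s` for `s ∈ [0, σ]`
and `Φ(u) + W j (s - u) ≤ W (j+1) s` for all `j ≥ 1`, `0 ≤ u ≤ s ≤ σ`, then for every `j ≥ 1` and every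
`t : Fin j → ℝ` with `t_m ≥ 0` and `∑ t = s ≤ σ` one has `∑_m Φ(t_m) ≤ W j s` — the value functions
`V_j(s) = sup{∑_{m<j} Φ(t_m) : t ≥ 0, ∑ t = s}` obey `V_{j+1}(s) = sup_u [Φ(u) + V_j(s-u)]`, so any family `W`
closed under this sup-convolution dominates them (Bellman's functional equation for the problem
`max ∑_{i=1}^N g_i(x_i)` subject to `x_1 + ⋯ + x_N = c`, `x_i ≥ 0`: `f_N(c) = max_{0 ≤ x ≤ c} [g_N(x) + f_{N-1}(c - x)]`,
`f_1(c) = g_1(c)`).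
[cite: Bellman1957, Ch. I §6 (a multi-dimensional maximization problem), eqs. (3)–(5)] -/
theorem sum_le_of_supConv_ladder {Φ : ℝ → ℝ} {σ : ℝ} (W : ℕ → ℝ → ℝ)
    (h1 : ∀ s : ℝ, 0 ≤ s → s ≤ σ → Φ s ≤ W 1 s)
    (hstep : ∀ j : ℕ, 1 ≤ j → ∀ s u : ℝ, 0 ≤ u → u ≤ s → s ≤ σ → Φ u + W j (s - u) ≤ W (j + 1) s) :
    ∀ j : ℕ, 1 ≤ j → ∀ t : Fin j → ℝ, (∀ m, 0 ≤ t m) → ∑ m, t m ≤ σ → ∑ m, Φ (t m) ≤ W j (∑ m, t m) := by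
  intro j hj
  induction j with
  | zero => exact absurd hj (by norm_num)
  | succ j ih =>
    intro t ht hts
    rcases Nat.eq_zero_or_pos j with hj0 | hj0
    · -- one coordinate
      subst hj0
      have hsum : ∑ m : Fin 1, t m = t 0 := by simp
      have hsumΦ : ∑ m : Fin 1, Φ (t m) = Φ (t 0) := by simp
      rw [hsum, hsumΦ]
      exact h1 (t 0) (ht 0) (by simpa [hsum] using hts)
    · -- peel off the first coordinate
      have hsplit : ∑ m : Fin (j + 1), t m = t 0 + ∑ m : Fin j, t (Fin.succ m) := Fin.sum_univ_succ t
      have hsplitΦ : ∑ m : Fin (j + 1), Φ (t m) = Φ (t 0) + ∑ m : Fin j, Φ (t (Fin.succ m)) :=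
        Fin.sum_univ_succ fun m => Φ (t m)
      have htail0 : ∀ m : Fin j, 0 ≤ t (Fin.succ m) := fun m => ht _
      have htail_nonneg : 0 ≤ ∑ m : Fin j, t (Fin.succ m) := Finset.sum_nonneg fun m _ => htail0 m
      have htail_le : ∑ m : Fin j, t (Fin.succ m) ≤ σ := by linarith [ht 0]
      have IH := ih hj0 (fun m => t (Fin.succ m)) htail0 htail_le
      have hrest : ∑ m : Fin j, t (Fin.succ m) = ∑ m : Fin (j + 1), t m - t 0 := by rw [hsplit]; ring
      rw [hsplitΦ]
      calc Φ (t 0) + ∑ m : Fin j, Φ (t (Fin.succ m))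
          ≤ Φ (t 0) + W j (∑ m : Fin j, t (Fin.succ m)) := by linarith
        _ = Φ (t 0) + W j (∑ m : Fin (j + 1), t m - t 0) := by rw [hrest]
        _ ≤ W (j + 1) (∑ m : Fin (j + 1), t m) :=
            hstep j hj0 _ _ (ht 0) (by linarith) hts

/-- **One block.**  `∑_{m<1} Φ(t_m) ≤ W(∑ t)` for `t : Fin 1 → ℝ≥0` with `∑ t ≤ σ` whenever `Φ ≤ W` on `[0, σ]`
(the initial condition `f_1 = g_1` of Bellman's recursion). [cite: Bellman1957, Ch. I §6, eq. (5)] -/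
theorem sum_le_of_block_one {Φ : ℝ → ℝ} {σ : ℝ} (W : ℝ → ℝ)
    (h1 : ∀ s : ℝ, 0 ≤ s → s ≤ σ → Φ s ≤ W s) :
    ∀ t : Fin 1 → ℝ, (∀ m, 0 ≤ t m) → ∑ m, t m ≤ σ → ∑ m, Φ (t m) ≤ W (∑ m, t m) := by
  intro t ht hts
  have hsum : ∑ m : Fin 1, t m = t 0 := by simp
  have hsumΦ : ∑ m : Fin 1, Φ (t m) = Φ (t 0) := by simp
  rw [hsum, hsumΦ]
  exact h1 (t 0) (ht 0) (by simpa [hsum] using hts)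

/-- **Merging two blocks** (sup-convolution of block bounds): if `∑_{m<a} Φ(t_m) ≤ W_a(∑ t)` for all
`t : Fin a → ℝ≥0` with `∑ t ≤ σ`, similarly for `b` with `W_b`, and `W_a(s₁) + W_b(s₂) ≤ W_{a+b}(s₁+s₂)` for
`s₁, s₂ ≥ 0`, `s₁ + s₂ ≤ σ`, then `∑_{m<a+b} Φ(t_m) ≤ W_{a+b}(∑ t)` for all `t : Fin (a+b) → ℝ≥0` with `∑ t ≤ σ`.
With `sum_le_of_block_one` this builds certificates for `k` coordinates along any addition chain for `k`
(e.g. doubling `W_{2a}(s) ≥ sup_u [W_a(u) + W_a(s-u)]`), a coarser but shorter alternative to the step-by-one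
ladder `sum_le_of_supConv_ladder` (Bellman's recursion groups the variables one at a time; grouping them in
blocks is the same principle of optimality). [cite: Bellman1957, Ch. I §6, eqs. (3)–(5)] -/
theorem sum_le_of_block_merge {Φ : ℝ → ℝ} {σ : ℝ} {a b : ℕ} (Wa Wb Wab : ℝ → ℝ)
    (ha : ∀ t : Fin a → ℝ, (∀ m, 0 ≤ t m) → ∑ m, t m ≤ σ → ∑ m, Φ (t m) ≤ Wa (∑ m, t m))
    (hb : ∀ t : Fin b → ℝ, (∀ m, 0 ≤ t m) → ∑ m, t m ≤ σ → ∑ m, Φ (t m) ≤ Wb (∑ m, t m))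
    (hmerge : ∀ s₁ s₂ : ℝ, 0 ≤ s₁ → 0 ≤ s₂ → s₁ + s₂ ≤ σ → Wa s₁ + Wb s₂ ≤ Wab (s₁ + s₂)) :
    ∀ t : Fin (a + b) → ℝ, (∀ m, 0 ≤ t m) → ∑ m, t m ≤ σ → ∑ m, Φ (t m) ≤ Wab (∑ m, t m) := by
  intro t ht hts
  have hsplit : ∑ m : Fin (a + b), t m =
      ∑ i : Fin a, t (Fin.castAdd b i) + ∑ j : Fin b, t (Fin.natAdd a j) := Fin.sum_univ_add t
  have hsplitΦ : ∑ m : Fin (a + b), Φ (t m) =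
      ∑ i : Fin a, Φ (t (Fin.castAdd b i)) + ∑ j : Fin b, Φ (t (Fin.natAdd a j)) :=
    Fin.sum_univ_add fun m => Φ (t m)
  have h1nn : 0 ≤ ∑ i : Fin a, t (Fin.castAdd b i) := Finset.sum_nonneg fun i _ => ht _
  have h2nn : 0 ≤ ∑ j : Fin b, t (Fin.natAdd a j) := Finset.sum_nonneg fun j _ => ht _
  have h1le : ∑ i : Fin a, t (Fin.castAdd b i) ≤ σ := by linarith
  have h2le : ∑ j : Fin b, t (Fin.natAdd a j) ≤ σ := by linarith
  have hA := ha (fun i => t (Fin.castAdd b i)) (fun i => ht _) h1le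
  have hB := hb (fun j => t (Fin.natAdd a j)) (fun j => ht _) h2le
  rw [hsplitΦ, hsplit]
  calc ∑ i : Fin a, Φ (t (Fin.castAdd b i)) + ∑ j : Fin b, Φ (t (Fin.natAdd a j))
      ≤ Wa (∑ i : Fin a, t (Fin.castAdd b i)) + Wb (∑ j : Fin b, t (Fin.natAdd a j)) := add_le_add hA hB
    _ ≤ Wab (∑ i : Fin a, t (Fin.castAdd b i) + ∑ j : Fin b, t (Fin.natAdd a j)) :=
        hmerge _ _ h1nn h2nn (by rw [← hsplit]; exact hts)

end MaynardCW

open MaynardCW in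
/-- **Exact order-one bound for `M_k` certified by a sup-convolution ladder.**  Let `ψ` be as in
`maynardFunctional_le_of_orderOne_weights` and `Φ_σ = orderOnePayoff ψ σ`.  Suppose that for every `σ ∈ [0,1]`
there is a ladder `W σ : ℕ → ℝ → ℝ` with `Φ_σ(s) ≤ W σ 1 s` (`0 ≤ s ≤ σ`),
`Φ_σ(u) + W σ j (s-u) ≤ W σ (j+1) s` (`j ≥ 1`, `0 ≤ u ≤ s ≤ σ`) and `W σ (n+1) σ ≤ Λ`.  Then
`∑_m Φ_σ(t_m) ≤ W σ (n+1) σ ≤ Λ` at every `t ∈ R_{n+1}` with `∑ t = σ` (`sum_le_of_supConv_ladder`), hence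
`(∑_m J^{(m)}_{n+1}(F))/I_{n+1}(F) ≤ Λ` for every admissible `F` by Lemma 6.1 for order-one weights
(`maynardFunctional_le_of_orderOnePayoff_sum_le`).  This certifies the EXACT order-one dual bound
`sup_{t ∈ R_k} ∑_m Φ_{∑t}(t_m)` (a `k`-dimensional supremum of a separable sum) through `k - 1` two-variable
inequalities per `σ`, with no structural assumption on the maximisers.
[cite: Polymath8b2014, Lemma 6.1 and proof of Corollary 6.4 (§6); Bellman1957, Ch. I §6, eqs. (3)–(5)] -/
theorem maynardFunctional_le_of_orderOne_supConv {n : ℕ} {Λ : ℝ} (ψ : ℝ → ℝ → ℝ)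
    (hψm : Measurable fun p : ℝ × ℝ => ψ p.1 p.2)
    (hψpos : ∀ u ℓ : ℝ, 0 < u → u ≤ ℓ → ℓ ≤ 1 → 0 < ψ u ℓ)
    (hnorm : ∀ ℓ : ℝ, 0 ≤ ℓ → ℓ ≤ 1 → ∫⁻ u in Ioc (0:ℝ) ℓ, ENNReal.ofReal (ψ u ℓ) ≤ 1)
    (W : ℝ → ℕ → ℝ → ℝ)
    (h1 : ∀ σ ∈ Icc (0:ℝ) 1, ∀ s : ℝ, 0 ≤ s → s ≤ σ → orderOnePayoff ψ σ s ≤ W σ 1 s)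
    (hstep : ∀ σ ∈ Icc (0:ℝ) 1, ∀ j : ℕ, 1 ≤ j → ∀ s u : ℝ, 0 ≤ u → u ≤ s → s ≤ σ →
      orderOnePayoff ψ σ u + W σ j (s - u) ≤ W σ (j + 1) s)
    (hΛ : ∀ σ ∈ Icc (0:ℝ) 1, W σ (n + 1) σ ≤ Λ)
    {F : (Fin (n + 1) → ℝ) → ℝ} (hF : IsMaynardAdmissible (n + 1) F) :
    maynardFunctional (n + 1) F ≤ Λ := by
  -- `Λ ≥ 0` from the point `t = 0` (`σ = 0`): the ladder gives `0 = ∑ Φ_0(0) ≤ W 0 (n+1) 0 ≤ Λ`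
  have hΛ0 : 0 ≤ Λ := by
    have h0 : (0:ℝ) ∈ Icc (0:ℝ) 1 := ⟨le_rfl, zero_le_one⟩
    have h := sum_le_of_supConv_ladder (W 0) (h1 0 h0) (hstep 0 h0) (n + 1) (Nat.succ_pos n)
      (fun _ => (0:ℝ)) (fun _ => le_rfl) (by simp)
    simp only [Finset.sum_const_zero, orderOnePayoff_of_not_pos ψ (lt_irrefl 0)] at h
    exact h.trans (hΛ 0 h0)
  refine maynardFunctional_le_of_orderOnePayoff_sum_le ψ hψm hψpos hnorm hΛ0 ?_ hF
  intro t ht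
  set σ : ℝ := ∑ j, t j with hσ
  have hσmem : σ ∈ Icc (0:ℝ) 1 := ⟨Finset.sum_nonneg fun j _ => ht.1 j, ht.2⟩
  have h := sum_le_of_supConv_ladder (W σ) (h1 σ hσmem) (hstep σ hσmem) (n + 1) (Nat.succ_pos n)
    t ht.1 (le_of_eq hσ.symm)
  rw [← hσ] at h
  exact h.trans (hΛ σ hσmem)

open MaynardCW in
/-- **Exact order-one bound from block certificates.**  If for every `σ ∈ [0,1]` a bound
`∑_m Φ_σ(t_m) ≤ W σ (∑ t)` is known for all `t : Fin (n+1) → ℝ≥0` with `∑ t ≤ σ` (assembled from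
`sum_le_of_block_one` / `sum_le_of_block_merge` / `sum_le_of_supConv_ladder` along any addition chain for `n+1`),
and `W σ σ ≤ Λ`, then `(∑_m J^{(m)}_{n+1}(F))/I_{n+1}(F) ≤ Λ` for every admissible `F`.
[cite: Polymath8b2014, Lemma 6.1 and proof of Corollary 6.4 (§6); Bellman1957, Ch. I §6, eqs. (3)–(5)] -/
theorem maynardFunctional_le_of_orderOne_blocks {n : ℕ} {Λ : ℝ} (ψ : ℝ → ℝ → ℝ)
    (hψm : Measurable fun p : ℝ × ℝ => ψ p.1 p.2)
    (hψpos : ∀ u ℓ : ℝ, 0 < u → u ≤ ℓ → ℓ ≤ 1 → 0 < ψ u ℓ)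
    (hnorm : ∀ ℓ : ℝ, 0 ≤ ℓ → ℓ ≤ 1 → ∫⁻ u in Ioc (0:ℝ) ℓ, ENNReal.ofReal (ψ u ℓ) ≤ 1)
    (W : ℝ → ℝ → ℝ)
    (hW : ∀ σ ∈ Icc (0:ℝ) 1, ∀ t : Fin (n + 1) → ℝ, (∀ m, 0 ≤ t m) → ∑ m, t m ≤ σ →
      ∑ m, orderOnePayoff ψ σ (t m) ≤ W σ (∑ m, t m))
    (hΛ : ∀ σ ∈ Icc (0:ℝ) 1, W σ σ ≤ Λ)
    {F : (Fin (n + 1) → ℝ) → ℝ} (hF : IsMaynardAdmissible (n + 1) F) :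
    maynardFunctional (n + 1) F ≤ Λ := by
  have hΛ0 : 0 ≤ Λ := by
    have h0 : (0:ℝ) ∈ Icc (0:ℝ) 1 := ⟨le_rfl, zero_le_one⟩
    have h := hW 0 h0 (fun _ => (0:ℝ)) (fun _ => le_rfl) (by simp)
    simp only [Finset.sum_const_zero, orderOnePayoff_of_not_pos ψ (lt_irrefl 0)] at h
    exact h.trans (hΛ 0 h0)
  refine maynardFunctional_le_of_orderOnePayoff_sum_le ψ hψm hψpos hnorm hΛ0 ?_ hF
  intro t ht
  set σ : ℝ := ∑ j, t j with hσ
  have hσmem : σ ∈ Icc (0:ℝ) 1 := ⟨Finset.sum_nonneg fun j _ => ht.1 j, ht.2⟩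
  have h := hW σ hσmem t ht.1 (le_of_eq hσ.symm)
  rw [← hσ] at h
  exact h.trans (hΛ σ hσmem)

end Literature.NumberTheory.Sieve
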